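import Mathlib

/-!
# `Φ₀` for two petals: the full charging inequality (the `n = 2` case of CONJECTURE Φ₀, abstract form)

Normalised two-petal setting (files `…SunflowerPhiZeroPair*`): masses `ε_Y, ε_g, ε_h ≥ 0` with `c = 1 − ε_Y − ε_g − ε_h ≥ 0`,
leverage `κ > 0`; petal `j` has Ȳ-usage `x_j`, g-usage `z_j ≥ 1`, h-usage `r_j ≥ 1` with the link `κ z_j ≤ r_j` (`g ≤ h`),
value `V_j = c + ε_Y x_j + ε_g z_j + ε_h r_j`.  Two model facts are assumed abstractly for each petal:

* (A′) `(ε_g + κε_h)(z_j − 1) ≤ (1 − ε_Y)(x_j − 1)` — the Ȳ-excess covers the g-excess (model: `ε_k(1−ε_Y) ≥ ε_Y(ε_g+κε_h)`,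
  i.e. the leaf-leaf constant condition `c₀ + q b_H ≥ (1−τ) b_Ȳ`, times `a_j ≥ ε_k(k̂_j−1) ≥ ε_k(z_j−1)`; `model_tying_Yg`);
* (T1) `ε_h ε_Y (x_j − 1) ≤ θ ε_g/κ` with `0 ≤ θ ≤ c` — leverage tying (model: `θ = τσ/g ≤ c₀/g = c`; `model_tying_hpetal`).

`charging_pair`: under these, `cross ≤ pay` (the hypothesis of `pair_le_phi0G_of_charging`), hence
`V₁V₂ ≤ Φ₀ᴳ = c + ε_Y x₁x₂ + ε_g·max(k₁k₂, r₁r₂/κ) + ε_h r₁r₂ ≤ Φ₀` for EVERY pair of petals (feed it to `pair_le_phi0G_of_charging` of `…SunflowerPhiZeroPair`).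
Proof (prove-1 g54 memo §7(g)(ix)): with `s_j = (1−ε_Y)(x_j−1) − ε_g(z_j−1) − ε_h(r_j−1)`, `M = (r₁r₂/κ − z₁z₂)₊`,
`stuff = ε_g(z₁−1)(z₂−1) + ε_h(r₁−1)(r₂−1) + ε_g M`, `b_j = ε_g(z_j−1) + ε_h(r_j−1)`:
`(1−ε_Y)(pay − cross) = ε_Y s₁s₂ + c·stuff + [(ε_g+ε_h)stuff − b₁b₂]`, the bracket is `≥ 0` by the links (H-side lemma),
so the same-sign case is free; if `s₁ < 0 < s₂` then `|s₁| ≤ ε_h η₁`, `η₁ = (r₁−1) − κ(z₁−1)` (by A′), `s₂ ≤ (1−ε_Y)(x₂−1)`,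
so `ε_Y|s₁|s₂ ≤ (1−ε_Y) η₁ θ ε_g/κ ≤ c ε_g η₁/κ ≤ c ε_g((z₁−1)(z₂−1) + M) ≤ c·stuff` by the pot lemma `η₁ ≤ κ((z₁−1)(z₂−1) + M)`
(`hexcess_le_pot`).  Numerically the abstract statement was checked on 290k random instances (pair_abstract.py).  [this work]
-/

namespace Summit.CriticalPhenomena.PercolationContinuityZ3.Theorems.SunflowerPartition.SafeCalc.LinkedCurrency

/-- Pot lemma: the uncovered h-excess `η₁ = (r₁−1) − κ(z₁−1)` of petal 1 satisfies `η₁ ≤ κ((z₁−1)(z₂−1) + M)` for any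
`M ≥ r₁r₂/κ − z₁z₂`, when `r₁, r₂ ≥ 1` and `κ z₂ ≤ r₂` (`κ > 0`). [this work] -/
theorem hexcess_le_pot {κ z₁ z₂ r₁ r₂ M : ℝ} (hκ : 0 < κ) (hr1 : 1 ≤ r₁) (hr2 : 1 ≤ r₂) (hl2 : κ * z₂ ≤ r₂)
    (hM : r₁ * r₂ / κ - z₁ * z₂ ≤ M) :
    (r₁ - 1) - κ * (z₁ - 1) ≤ κ * ((z₁ - 1) * (z₂ - 1) + M) := by
  have hκM : r₁ * r₂ - κ * (z₁ * z₂) ≤ κ * M := by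
    have := mul_le_mul_of_nonneg_left hM hκ.le
    have e : κ * (r₁ * r₂ / κ - z₁ * z₂) = r₁ * r₂ - κ * (z₁ * z₂) := by field_simp
    linarith [e]
  nlinarith [mul_nonneg (sub_nonneg.2 hr1) (sub_nonneg.2 hr2)]

/-- H-side lemma (inline form): `(ε_g(z₁−1)+ε_h(r₁−1))(ε_g(z₂−1)+ε_h(r₂−1)) ≤ (ε_g+ε_h)·stuff` under the links. [this work] -/
theorem hside_le_stuff {εg εh κ z₁ z₂ r₁ r₂ M : ℝ} (hεg : 0 ≤ εg) (hεh : 0 ≤ εh) (hκ : 0 < κ)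
    (hr1 : 1 ≤ r₁) (hr2 : 1 ≤ r₂) (hl1 : κ * z₁ ≤ r₁) (hl2 : κ * z₂ ≤ r₂)
    (hM : r₁ * r₂ / κ - z₁ * z₂ ≤ M) (hM0 : 0 ≤ M) :
    (εg * (z₁ - 1) + εh * (r₁ - 1)) * (εg * (z₂ - 1) + εh * (r₂ - 1)) ≤
      (εg + εh) * (εg * ((z₁ - 1) * (z₂ - 1)) + εh * ((r₁ - 1) * (r₂ - 1)) + εg * M) := by
  -- M ≥ z₁ (r₂ − z₂) and M ≥ z₂ (r₁ − z₁) from the links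
  have hw1 : z₁ ≤ r₁ / κ := by rw [le_div_iff₀ hκ]; linarith
  have hw2 : z₂ ≤ r₂ / κ := by rw [le_div_iff₀ hκ]; linarith
  have hM1 : z₁ * (r₂ - z₂) ≤ M := by
    have e : r₁ / κ * r₂ = r₁ * r₂ / κ := by ring
    have := mul_le_mul_of_nonneg_right hw1 (by linarith : (0:ℝ) ≤ r₂)
    rw [e] at this; nlinarith
  have hM2 : z₂ * (r₁ - z₁) ≤ M := by
    have e : r₁ * (r₂ / κ) = r₁ * r₂ / κ := by ring
    have := mul_le_mul_of_nonneg_left hw2 (by linarith : (0:ℝ) ≤ r₁)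
    rw [e] at this; nlinarith
  -- mismatch + M ≥ 0
  have hmm : 0 ≤ ((z₁ - 1) - (r₁ - 1)) * ((z₂ - 1) - (r₂ - 1)) + M := by
    rcases le_total z₁ r₁ with h1 | h1 <;> rcases le_total z₂ r₂ with h2 | h2
    · nlinarith [mul_nonneg (sub_nonneg.2 h1) (sub_nonneg.2 h2)]
    · nlinarith [mul_nonneg (sub_nonneg.2 h1) (sub_nonneg.2 h2), mul_nonneg (by linarith : (0:ℝ) ≤ r₂ - 1) (sub_nonneg.2 h1)]
    · nlinarith [mul_nonneg (sub_nonneg.2 h1) (sub_nonneg.2 h2), mul_nonneg (by linarith : (0:ℝ) ≤ r₁ - 1) (sub_nonneg.2 h2)]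
    · nlinarith [mul_nonneg (sub_nonneg.2 h1) (sub_nonneg.2 h2)]
  have key : (εg + εh) * (εg * ((z₁ - 1) * (z₂ - 1)) + εh * ((r₁ - 1) * (r₂ - 1)) + εg * M) -
      (εg * (z₁ - 1) + εh * (r₁ - 1)) * (εg * (z₂ - 1) + εh * (r₂ - 1)) =
      εg * εh * (((z₁ - 1) - (r₁ - 1)) * ((z₂ - 1) - (r₂ - 1)) + M) + εg * εg * M := by ring
  nlinarith [mul_nonneg (mul_nonneg hεg hεh) hmm, mul_nonneg (mul_nonneg hεg hεg) hM0]

/-- Mixed-sign payment (one orientation): the uncovered h-excess of petal 1 times the Ȳ-excess of petal 2 is paid by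
`c·stuff`:  `ε_Y · ε_hη₁ · (1−ε_Y)(x₂−1) ≤ c·(ε_g(z₁−1)(z₂−1) + ε_h(r₁−1)(r₂−1) + ε_g M)`, using (T1) for petal 2, `θ ≤ c`
and `hexcess_le_pot`. [this work] -/
theorem mixed_payment {εY εg εh κ θ c x₂ z₁ z₂ r₁ r₂ M : ℝ}
    (hY0 : 0 ≤ εY) (hY1 : εY ≤ 1) (hεg : 0 ≤ εg) (hεh : 0 ≤ εh) (hθ0 : 0 ≤ θ) (hθc : θ ≤ c)
    (hκ : 0 < κ) (hz1 : 1 ≤ z₁) (hz2 : 1 ≤ z₂) (hr1 : 1 ≤ r₁) (hr2 : 1 ≤ r₂) (hl2 : κ * z₂ ≤ r₂)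
    (hM : r₁ * r₂ / κ - z₁ * z₂ ≤ M) (hM0 : 0 ≤ M)
    (hx2 : 1 ≤ x₂) (hT2 : εh * εY * (x₂ - 1) ≤ θ * εg / κ) :
    εY * (εh * ((r₁ - 1) - κ * (z₁ - 1))) * ((1 - εY) * (x₂ - 1)) ≤
      c * (εg * ((z₁ - 1) * (z₂ - 1)) + εh * ((r₁ - 1) * (r₂ - 1)) + εg * M) := by
  have hc0 : 0 ≤ c := hθ0.trans hθc
  have hzzM : 0 ≤ (z₁ - 1) * (z₂ - 1) + M := add_nonneg (mul_nonneg (by linarith) (by linarith)) hM0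
  have hstuff : εg * ((z₁ - 1) * (z₂ - 1) + M) ≤
      εg * ((z₁ - 1) * (z₂ - 1)) + εh * ((r₁ - 1) * (r₂ - 1)) + εg * M := by
    nlinarith [mul_nonneg hεh (mul_nonneg (by linarith : (0:ℝ) ≤ r₁ - 1) (by linarith : (0:ℝ) ≤ r₂ - 1))]
  rcases le_total 0 ((r₁ - 1) - κ * (z₁ - 1)) with hη | hη
  · -- η₁ ≥ 0 :  ε_Y ε_h η₁ (1−ε_Y)(x₂−1) = (1−ε_Y) η₁ (ε_h ε_Y (x₂−1)) ≤ (1−ε_Y) η₁ θ ε_g/κ ≤ c ε_g η₁/κ ≤ c ε_g (ζζ+M)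
    have hX := hexcess_le_pot (z₁ := z₁) hκ hr1 hr2 hl2 hM
    have hq : ((r₁ - 1) - κ * (z₁ - 1)) / κ ≤ (z₁ - 1) * (z₂ - 1) + M := by
      rw [div_le_iff₀ hκ]; linarith
    have e1 : εY * (εh * ((r₁ - 1) - κ * (z₁ - 1))) * ((1 - εY) * (x₂ - 1)) =
        ((1 - εY) * ((r₁ - 1) - κ * (z₁ - 1))) * (εh * εY * (x₂ - 1)) := by ring
    have e2 : ((1 - εY) * ((r₁ - 1) - κ * (z₁ - 1))) * (εh * εY * (x₂ - 1)) ≤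
        ((1 - εY) * ((r₁ - 1) - κ * (z₁ - 1))) * (θ * εg / κ) :=
      mul_le_mul_of_nonneg_left hT2 (mul_nonneg (by linarith) hη)
    have e3 : ((1 - εY) * ((r₁ - 1) - κ * (z₁ - 1))) * (θ * εg / κ) =
        ((1 - εY) * θ) * εg * (((r₁ - 1) - κ * (z₁ - 1)) / κ) := by ring
    have e4 : ((1 - εY) * θ) * εg * (((r₁ - 1) - κ * (z₁ - 1)) / κ) ≤
        ((1 - εY) * θ) * εg * ((z₁ - 1) * (z₂ - 1) + M) :=
      mul_le_mul_of_nonneg_left hq (mul_nonneg (mul_nonneg (by linarith) hθ0) hεg)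
    have e5 : ((1 - εY) * θ) * εg * ((z₁ - 1) * (z₂ - 1) + M) ≤ c * (εg * ((z₁ - 1) * (z₂ - 1) + M)) := by
      have hθ' : (1 - εY) * θ ≤ c := by nlinarith
      have := mul_le_mul_of_nonneg_right hθ' (mul_nonneg hεg hzzM)
      linarith
    have e6 : c * (εg * ((z₁ - 1) * (z₂ - 1) + M)) ≤
        c * (εg * ((z₁ - 1) * (z₂ - 1)) + εh * ((r₁ - 1) * (r₂ - 1)) + εg * M) :=
      mul_le_mul_of_nonneg_left hstuff hc0
    calc εY * (εh * ((r₁ - 1) - κ * (z₁ - 1))) * ((1 - εY) * (x₂ - 1))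
        = ((1 - εY) * ((r₁ - 1) - κ * (z₁ - 1))) * (εh * εY * (x₂ - 1)) := e1
      _ ≤ ((1 - εY) * ((r₁ - 1) - κ * (z₁ - 1))) * (θ * εg / κ) := e2
      _ = ((1 - εY) * θ) * εg * (((r₁ - 1) - κ * (z₁ - 1)) / κ) := e3
      _ ≤ ((1 - εY) * θ) * εg * ((z₁ - 1) * (z₂ - 1) + M) := e4
      _ ≤ c * (εg * ((z₁ - 1) * (z₂ - 1) + M)) := e5
      _ ≤ _ := e6
  · -- η₁ ≤ 0 : the left side is ≤ 0 ≤ c·stuff (x₂ ≥ 1)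
    have h1 : εY * (εh * ((r₁ - 1) - κ * (z₁ - 1))) * ((1 - εY) * (x₂ - 1)) ≤ 0 := by
      have a : εY * (εh * ((r₁ - 1) - κ * (z₁ - 1))) ≤ 0 := by
        have : εh * ((r₁ - 1) - κ * (z₁ - 1)) ≤ 0 := by nlinarith
        nlinarith
      have b : 0 ≤ (1 - εY) * (x₂ - 1) := mul_nonneg (by linarith) (by linarith)
      exact mul_nonpos_of_nonpos_of_nonneg a b
    linarith [mul_nonneg hc0 (le_trans (mul_nonneg hεg hzzM) hstuff)]

/-- **FULL CHARGING INEQUALITY FOR TWO PETALS** (the `n = 2` case of CONJECTURE Φ₀ in abstract form).  For masses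
`ε_Y, ε_g, ε_h ≥ 0`, `ε_Y < 1`, `c = 1 − ε_Y − ε_g − ε_h ≥ θ ≥ 0`, leverage `κ > 0`, and two petals with `z_j, r_j ≥ 1`,
links `κ z_j ≤ r_j`, (A′) `(ε_g+κε_h)(z_j−1) ≤ (1−ε_Y)(x_j−1)` and (T1) `ε_hε_Y(x_j−1) ≤ θε_g/κ`:  `cross ≤ pay`. [this work] -/
theorem charging_pair {εY εg εh κ θ x₁ x₂ z₁ z₂ r₁ r₂ : ℝ}
    (hY0 : 0 ≤ εY) (hY1 : εY < 1) (hεg : 0 ≤ εg) (hεh : 0 ≤ εh) (hθ0 : 0 ≤ θ) (hθc : θ ≤ 1 - εY - εg - εh)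
    (hκ : 0 < κ) (hz1 : 1 ≤ z₁) (hz2 : 1 ≤ z₂) (hr1 : 1 ≤ r₁) (hr2 : 1 ≤ r₂) (hl1 : κ * z₁ ≤ r₁) (hl2 : κ * z₂ ≤ r₂)
    (hA1 : (εg + κ * εh) * (z₁ - 1) ≤ (1 - εY) * (x₁ - 1)) (hA2 : (εg + κ * εh) * (z₂ - 1) ≤ (1 - εY) * (x₂ - 1))
    (hT1 : εh * εY * (x₁ - 1) ≤ θ * εg / κ) (hT2 : εh * εY * (x₂ - 1) ≤ θ * εg / κ) :
    εg * εY * ((x₁ - 1) * (z₂ - 1) + (x₂ - 1) * (z₁ - 1)) +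
        εh * εY * ((x₁ - 1) * (r₂ - 1) + (x₂ - 1) * (r₁ - 1)) +
        εg * εh * ((z₁ - 1) * (r₂ - 1) + (z₂ - 1) * (r₁ - 1)) ≤
      εY * (1 - εY) * ((x₁ - 1) * (x₂ - 1)) + εh * (1 - εh) * ((r₁ - 1) * (r₂ - 1)) +
        εg * (1 - εg) * ((z₁ - 1) * (z₂ - 1)) + εg * max (r₁ * r₂ / κ - z₁ * z₂) 0 := by
  obtain ⟨M, hMdef⟩ : ∃ M, M = max (r₁ * r₂ / κ - z₁ * z₂) 0 := ⟨_, rfl⟩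
  rw [← hMdef]
  have hM0 : 0 ≤ M := by rw [hMdef]; exact le_max_right _ _
  have hM : r₁ * r₂ / κ - z₁ * z₂ ≤ M := by rw [hMdef]; exact le_max_left _ _
  have hM' : r₂ * r₁ / κ - z₂ * z₁ ≤ M := by rw [mul_comm r₂, mul_comm z₂]; exact hM
  obtain ⟨c, hcdef⟩ : ∃ c, c = 1 - εY - εg - εh := ⟨_, rfl⟩
  have hc0 : 0 ≤ c := by rw [hcdef]; exact hθ0.trans hθc
  have hθc' : θ ≤ c := by rw [hcdef]; exact hθc
  have hY1' : 0 < 1 - εY := by linarith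
  -- x_j ≥ 1 from (A′)
  have hx1 : 1 ≤ x₁ := by
    have h0 : 0 ≤ (εg + κ * εh) * (z₁ - 1) := mul_nonneg (by nlinarith) (by linarith)
    by_contra h
    have : (1 - εY) * (x₁ - 1) < 0 := mul_neg_of_pos_of_neg hY1' (by linarith)
    linarith
  have hx2 : 1 ≤ x₂ := by
    have h0 : 0 ≤ (εg + κ * εh) * (z₂ - 1) := mul_nonneg (by nlinarith) (by linarith)
    by_contra h
    have : (1 - εY) * (x₂ - 1) < 0 := mul_neg_of_pos_of_neg hY1' (by linarith)
    linarith
  obtain ⟨s₁, hs1⟩ : ∃ s, s = (1 - εY) * (x₁ - 1) - εg * (z₁ - 1) - εh * (r₁ - 1) := ⟨_, rfl⟩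
  obtain ⟨s₂, hs2⟩ : ∃ s, s = (1 - εY) * (x₂ - 1) - εg * (z₂ - 1) - εh * (r₂ - 1) := ⟨_, rfl⟩
  obtain ⟨stuff, hstuff⟩ : ∃ t, t = εg * ((z₁ - 1) * (z₂ - 1)) + εh * ((r₁ - 1) * (r₂ - 1)) + εg * M := ⟨_, rfl⟩
  have hstuff0 : 0 ≤ stuff := by
    rw [hstuff]
    exact add_nonneg (add_nonneg (mul_nonneg hεg (mul_nonneg (by linarith) (by linarith)))
      (mul_nonneg hεh (mul_nonneg (by linarith) (by linarith)))) (mul_nonneg hεg hM0)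
  have hH : (εg * (z₁ - 1) + εh * (r₁ - 1)) * (εg * (z₂ - 1) + εh * (r₂ - 1)) ≤ (εg + εh) * stuff := by
    rw [hstuff]; exact hside_le_stuff hεg hεh hκ hr1 hr2 hl1 hl2 hM hM0
  have key : (1 - εY) * ((εY * (1 - εY) * ((x₁ - 1) * (x₂ - 1)) + εh * (1 - εh) * ((r₁ - 1) * (r₂ - 1)) +
        εg * (1 - εg) * ((z₁ - 1) * (z₂ - 1)) + εg * M) -
      (εg * εY * ((x₁ - 1) * (z₂ - 1) + (x₂ - 1) * (z₁ - 1)) +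
        εh * εY * ((x₁ - 1) * (r₂ - 1) + (x₂ - 1) * (r₁ - 1)) +
        εg * εh * ((z₁ - 1) * (r₂ - 1) + (z₂ - 1) * (r₁ - 1)))) =
      εY * (s₁ * s₂) + (c * stuff + ((εg + εh) * stuff -
        (εg * (z₁ - 1) + εh * (r₁ - 1)) * (εg * (z₂ - 1) + εh * (r₂ - 1)))) := by
    rw [hs1, hs2, hstuff, hcdef]; ring
  -- sign bounds on s_j
  have hn1 : -s₁ ≤ εh * ((r₁ - 1) - κ * (z₁ - 1)) := by rw [hs1]; linarith
  have hn2 : -s₂ ≤ εh * ((r₂ - 1) - κ * (z₂ - 1)) := by rw [hs2]; linarith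
  have hp1 : s₁ ≤ (1 - εY) * (x₁ - 1) := by
    rw [hs1]; linarith [mul_nonneg hεg (by linarith : (0:ℝ) ≤ z₁ - 1), mul_nonneg hεh (by linarith : (0:ℝ) ≤ r₁ - 1)]
  have hp2 : s₂ ≤ (1 - εY) * (x₂ - 1) := by
    rw [hs2]; linarith [mul_nonneg hεg (by linarith : (0:ℝ) ≤ z₂ - 1), mul_nonneg hεh (by linarith : (0:ℝ) ≤ r₂ - 1)]
  -- the two mixed payments
  have pay12 : εY * (εh * ((r₁ - 1) - κ * (z₁ - 1))) * ((1 - εY) * (x₂ - 1)) ≤ c * stuff := by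
    rw [hstuff]; exact mixed_payment hY0 hY1.le hεg hεh hθ0 hθc' hκ hz1 hz2 hr1 hr2 hl2 hM hM0 hx2 hT2
  have pay21 : εY * (εh * ((r₂ - 1) - κ * (z₂ - 1))) * ((1 - εY) * (x₁ - 1)) ≤ c * stuff := by
    have h := mixed_payment hY0 hY1.le hεg hεh hθ0 hθc' hκ hz2 hz1 hr2 hr1 hl1 hM' hM0 hx1 hT1
    have e : εg * ((z₂ - 1) * (z₁ - 1)) + εh * ((r₂ - 1) * (r₁ - 1)) + εg * M = stuff := by rw [hstuff]; ring
    rw [e] at h; exact h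
  -- main: ε_Y s₁ s₂ + c stuff ≥ 0, by the four sign cases
  have hmain : 0 ≤ εY * (s₁ * s₂) + c * stuff := by
    rcases le_total 0 s₁ with h1 | h1 <;> rcases le_total 0 s₂ with h2 | h2
    · exact add_nonneg (mul_nonneg hY0 (mul_nonneg h1 h2)) (mul_nonneg hc0 hstuff0)
    · -- s₁ ≥ 0 ≥ s₂
      have hN2 : 0 ≤ εh * ((r₂ - 1) - κ * (z₂ - 1)) := le_trans (by linarith) hn2
      have a : s₁ * (-s₂) ≤ s₁ * (εh * ((r₂ - 1) - κ * (z₂ - 1))) := mul_le_mul_of_nonneg_left hn2 h1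
      have b : s₁ * (εh * ((r₂ - 1) - κ * (z₂ - 1))) ≤
          ((1 - εY) * (x₁ - 1)) * (εh * ((r₂ - 1) - κ * (z₂ - 1))) := mul_le_mul_of_nonneg_right hp1 hN2
      have lb : -(((1 - εY) * (x₁ - 1)) * (εh * ((r₂ - 1) - κ * (z₂ - 1)))) ≤ s₁ * s₂ := by linarith
      have d := mul_le_mul_of_nonneg_left lb hY0
      have e : εY * -(((1 - εY) * (x₁ - 1)) * (εh * ((r₂ - 1) - κ * (z₂ - 1)))) =
          -(εY * (εh * ((r₂ - 1) - κ * (z₂ - 1))) * ((1 - εY) * (x₁ - 1))) := by ring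
      rw [e] at d
      linarith
    · -- s₁ ≤ 0 ≤ s₂
      have hN1 : 0 ≤ εh * ((r₁ - 1) - κ * (z₁ - 1)) := le_trans (by linarith) hn1
      have a : (-s₁) * s₂ ≤ (εh * ((r₁ - 1) - κ * (z₁ - 1))) * s₂ := mul_le_mul_of_nonneg_right hn1 h2
      have b : (εh * ((r₁ - 1) - κ * (z₁ - 1))) * s₂ ≤
          (εh * ((r₁ - 1) - κ * (z₁ - 1))) * ((1 - εY) * (x₂ - 1)) := mul_le_mul_of_nonneg_left hp2 hN1
      have lb : -((εh * ((r₁ - 1) - κ * (z₁ - 1))) * ((1 - εY) * (x₂ - 1))) ≤ s₁ * s₂ := by linarith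
      have d := mul_le_mul_of_nonneg_left lb hY0
      have e : εY * -((εh * ((r₁ - 1) - κ * (z₁ - 1))) * ((1 - εY) * (x₂ - 1))) =
          -(εY * (εh * ((r₁ - 1) - κ * (z₁ - 1))) * ((1 - εY) * (x₂ - 1))) := by ring
      rw [e] at d
      linarith
    · exact add_nonneg (mul_nonneg hY0 (mul_nonneg_of_nonpos_of_nonpos h1 h2)) (mul_nonneg hc0 hstuff0)
  have hD : 0 ≤ (εY * (1 - εY) * ((x₁ - 1) * (x₂ - 1)) + εh * (1 - εh) * ((r₁ - 1) * (r₂ - 1)) +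
        εg * (1 - εg) * ((z₁ - 1) * (z₂ - 1)) + εg * M) -
      (εg * εY * ((x₁ - 1) * (z₂ - 1) + (x₂ - 1) * (z₁ - 1)) +
        εh * εY * ((x₁ - 1) * (r₂ - 1) + (x₂ - 1) * (r₁ - 1)) +
        εg * εh * ((z₁ - 1) * (r₂ - 1) + (z₂ - 1) * (r₁ - 1))) := by
    rw [← mul_nonneg_iff_of_pos_left hY1', key]
    linarith
  linarith

/-- (Model instantiation of `charging_pair`; raw parameters, `g` passed with its defining equation.)  Model tying (A′) for one petal, `(ε_g+κε_h)(z−1) ≤ (1−ε_Y)(x−1)`, from the leaf-leaf constant (`(1−τ)b_Ȳ ≤ c₀ + q b_H`)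
and `Ȳ_j − b_Ȳ ≥ s(g_j − α₀₁)`. [this work] -/
theorem model_tying_A {τ σ s α00 α01 α11 c0 g yv kc gg : ℝ} (hτ0 : 0 < τ) (hτ1 : τ < 1) (hσ0 : 0 < σ) (hσ1 : σ < 1)
    (hs0 : 0 < s) (hs1 : s < 1) (hα00 : 0 < α00) (h01 : α00 ≤ α01) (h11 : α01 ≤ α11) (hc0 : τ * σ + (1 - s) * (1 - τ) * α00 ≤ c0)
    (hg : g = c0 + τ * (1 - σ) * ((1 - s) * α00 + s * α01) + s * (1 - τ) * ((1 - σ) * α01 + σ * α11))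
    (hyv : α00 ≤ yv) (hgg : α01 ≤ gg) (hgk : gg ≤ kc) :
    (s * (1 - τ) * (1 - σ) * α01 / g + α01 / α11 * (s * (1 - τ) * σ * α11 / g)) * (gg / α01 - 1) ≤
      (1 - τ * (1 - σ) * ((1 - s) * α00 + s * α01) / g) * (((1 - s) * yv + s * kc) / ((1 - s) * α00 + s * α01) - 1) := by
  obtain ⟨hα01, hα11⟩ : 0 < α01 ∧ 0 < α11 := ⟨lt_of_lt_of_le hα00 h01, lt_of_lt_of_le (lt_of_lt_of_le hα00 h01) h11⟩
  obtain ⟨hτ1', hσ1', hs1'⟩ : 0 < 1 - τ ∧ 0 < 1 - σ ∧ 0 < 1 - s := ⟨by linarith, by linarith, by linarith⟩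
  have hq0 : 0 < s * (1 - τ) := mul_pos hs0 hτ1'
  have hbH0 : 0 < (1 - σ) * α01 + σ * α11 := by linarith [mul_pos hσ1' hα01, mul_pos hσ0 hα11]
  obtain ⟨bY, hbY⟩ : ∃ b, b = (1 - s) * α00 + s * α01 := ⟨_, rfl⟩
  have hbY0 : 0 < bY := by rw [hbY]; linarith [mul_pos hs1' hα00, mul_pos hs0 hα01]
  rw [← hbY] at hg ⊢
  have hg0 : 0 < g := by
    rw [hg]; linarith [mul_pos (mul_pos hτ0 hσ1') hbY0, mul_pos hq0 hbH0, mul_pos hτ0 hσ0, mul_pos (mul_pos hs1' hτ1') hα00]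
  have e1 : s * (1 - τ) * (1 - σ) * α01 / g + α01 / α11 * (s * (1 - τ) * σ * α11 / g) = s * (1 - τ) * α01 / g := by
    field_simp; ring
  have e2 : 1 - τ * (1 - σ) * bY / g = (c0 + s * (1 - τ) * ((1 - σ) * α01 + σ * α11)) / g := by field_simp; rw [hg]; ring
  rw [e1, e2, show s * (1 - τ) * α01 / g * (gg / α01 - 1) = s * (1 - τ) * (gg - α01) / g by field_simp,
    show (c0 + s * (1 - τ) * ((1 - σ) * α01 + σ * α11)) / g * (((1 - s) * yv + s * kc) / bY - 1) =
      (c0 + s * (1 - τ) * ((1 - σ) * α01 + σ * α11)) * ((1 - s) * yv + s * kc - bY) / (g * bY) by field_simp,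
    div_le_div_iff₀ hg0 (mul_pos hg0 hbY0)]
  have hYex : s * (gg - α01) ≤ (1 - s) * yv + s * kc - bY := by
    rw [hbY]; linarith [mul_le_mul_of_nonneg_left hyv hs1'.le, mul_le_mul_of_nonneg_left hgk hs0.le]
  have hLL : (1 - τ) * bY ≤ c0 + s * (1 - τ) * ((1 - σ) * α01 + σ * α11) := by
    have e : c0 + s * (1 - τ) * ((1 - σ) * α01 + σ * α11) - (1 - τ) * ((1 - s) * α00 + s * α01) =
        (c0 - (1 - s) * (1 - τ) * α00) + s * (1 - τ) * σ * (α11 - α01) := by ring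
    have h1 : 0 ≤ s * (1 - τ) * σ * (α11 - α01) := mul_nonneg (mul_nonneg hq0.le hσ0.le) (sub_nonneg.2 h11)
    rw [hbY]; nlinarith [mul_pos hτ0 hσ0]
  have hkey : s * (1 - τ) * bY ≤ s * (c0 + s * (1 - τ) * ((1 - σ) * α01 + σ * α11)) := by
    have := mul_le_mul_of_nonneg_left hLL hs0.le; linarith
  have hgg0 : 0 ≤ gg - α01 := by linarith
  have hcq : 0 ≤ c0 + s * (1 - τ) * ((1 - σ) * α01 + σ * α11) := by linarith [mul_pos hq0 hbH0, mul_pos hτ0 hσ0, mul_pos (mul_pos hs1' hτ1') hα00]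
  calc s * (1 - τ) * (gg - α01) * (g * bY) = (s * (1 - τ) * bY) * (gg - α01) * g := by ring
    _ ≤ (s * (c0 + s * (1 - τ) * ((1 - σ) * α01 + σ * α11))) * (gg - α01) * g := by gcongr
    _ = (c0 + s * (1 - τ) * ((1 - σ) * α01 + σ * α11)) * (s * (gg - α01)) * g := by ring
    _ ≤ (c0 + s * (1 - τ) * ((1 - σ) * α01 + σ * α11)) * ((1 - s) * yv + s * kc - bY) * g := by gcongr

/-- Model tying (T1) for one petal: `ε_hε_Y(x − 1) ≤ θε_g/κ` with `θ = τσ/g`, from `Ȳ_j − b_Ȳ ≤ 1`. [this work] -/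
theorem model_tying_T {τ σ s α00 α01 α11 g Y : ℝ} (hτ0 : 0 < τ) (hσ0 : 0 < σ) (hσ1 : σ < 1) (hs0 : 0 < s) (hs1 : s < 1)
    (hτ1 : τ < 1) (hα00 : 0 < α00) (h01 : α00 ≤ α01) (h11 : α01 ≤ α11) (hg0 : 0 < g) (hY1 : Y ≤ 1) :
    (s * (1 - τ) * σ * α11 / g) * (τ * (1 - σ) * ((1 - s) * α00 + s * α01) / g) * (Y / ((1 - s) * α00 + s * α01) - 1) ≤
      (τ * σ / g) * (s * (1 - τ) * (1 - σ) * α01 / g) / (α01 / α11) := by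
  obtain ⟨hα01, hα11⟩ : 0 < α01 ∧ 0 < α11 := ⟨lt_of_lt_of_le hα00 h01, lt_of_lt_of_le (lt_of_lt_of_le hα00 h01) h11⟩
  obtain ⟨bY, hbY⟩ : ∃ b, b = (1 - s) * α00 + s * α01 := ⟨_, rfl⟩
  have hbY0 : 0 < bY := by rw [hbY]; linarith [mul_pos (by linarith : (0:ℝ) < 1 - s) hα00, mul_pos hs0 hα01]
  rw [← hbY]
  rw [show (s * (1 - τ) * σ * α11 / g) * (τ * (1 - σ) * bY / g) * (Y / bY - 1) =
      s * (1 - τ) * σ * α11 * (τ * (1 - σ) * (Y - bY)) / (g * g) by field_simp,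
    show (τ * σ / g) * (s * (1 - τ) * (1 - σ) * α01 / g) / (α01 / α11) = τ * σ * (s * (1 - τ) * (1 - σ) * α11) / (g * g) by field_simp]
  apply div_le_div_of_nonneg_right _ (mul_pos hg0 hg0).le
  have e : τ * σ * (s * (1 - τ) * (1 - σ) * α11) - s * (1 - τ) * σ * α11 * (τ * (1 - σ) * (Y - bY)) =
      (s * (1 - τ) * σ * α11) * (τ * (1 - σ)) * (1 - (Y - bY)) := by ring
  have hnn : 0 ≤ (s * (1 - τ) * σ * α11) * (τ * (1 - σ)) * (1 - (Y - bY)) :=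
    mul_nonneg (mul_nonneg (mul_nonneg (mul_nonneg (mul_nonneg hs0.le (by linarith)) hσ0.le) hα11.le)
      (mul_nonneg hτ0.le (by linarith))) (by linarith)
  linarith

/-- Model identities: `G_j = g·V_j` and the raw form of `g·(gΦ₀ᴳ)`, in the normalised masses and usages. [this work] -/
theorem model_value_eq {τ σ s α00 α01 α11 c0 g yv kc gg hh : ℝ} (hg0 : g ≠ 0) (hbY : (1 - s) * α00 + s * α01 ≠ 0)
    (hα01 : α01 ≠ 0) (hα11 : α11 ≠ 0) :
    c0 + τ * (1 - σ) * ((1 - s) * yv + s * kc) + s * (1 - τ) * ((1 - σ) * gg + σ * hh) =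
      g * (c0 / g + τ * (1 - σ) * ((1 - s) * α00 + s * α01) / g * (((1 - s) * yv + s * kc) / ((1 - s) * α00 + s * α01)) +
        s * (1 - τ) * (1 - σ) * α01 / g * (gg / α01) + s * (1 - τ) * σ * α11 / g * (hh / α11)) := by
  field_simp; ring

/-- The raw form of `g·(gΦ₀ᴳ)` for two petals. [this work] -/
theorem model_rhs_eq {τ σ s α00 α01 α11 c0 g Y₁ Y₂ k₁ k₂ h₁ h₂ : ℝ} (hg0 : g ≠ 0) (hbY : (1 - s) * α00 + s * α01 ≠ 0)
    (hα01 : α01 ≠ 0) (hα11 : α11 ≠ 0) :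
    c0 + τ * (1 - σ) * (Y₁ * Y₂) / ((1 - s) * α00 + s * α01) +
        s * (1 - τ) * (1 - σ) * α01 * max (k₁ * k₂ / (α01 * α01)) (h₁ * h₂ / (α01 * α11)) + s * (1 - τ) * σ * (h₁ * h₂) / α11 =
      g * (c0 / g + τ * (1 - σ) * ((1 - s) * α00 + s * α01) / g * ((Y₁ / ((1 - s) * α00 + s * α01)) * (Y₂ / ((1 - s) * α00 + s * α01))) +
        s * (1 - τ) * (1 - σ) * α01 / g * max (k₁ / α01 * (k₂ / α01)) (h₁ / α11 * (h₂ / α11) / (α01 / α11)) +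
        s * (1 - τ) * σ * α11 / g * (h₁ / α11 * (h₂ / α11))) := by
  have em : max (k₁ / α01 * (k₂ / α01)) (h₁ / α11 * (h₂ / α11) / (α01 / α11)) = max (k₁ * k₂ / (α01 * α01)) (h₁ * h₂ / (α01 * α11)) := by
    congr 1
    · rw [div_mul_div_comm]
    · field_simp
  obtain ⟨Mx, hMx⟩ : ∃ m, m = max (k₁ * k₂ / (α01 * α01)) (h₁ * h₂ / (α01 * α11)) := ⟨_, rfl⟩
  rw [em, ← hMx]; field_simp

/-- **Φ₀ FOR TWO PETALS IN THE MODEL** (the `n = 2` instance of `Phi0Conj`, G-branch form): parameters `τ, σ, s ∈ (0,1)`,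
`0 < α₀₀ ≤ α₀₁ ≤ α₁₁`, `τσ + (1−s)(1−τ)α₀₀ ≤ c₀`; petals `α₀₀ ≤ y_j ≤ k_j ≤ 1`, `α₀₁ ≤ g_j ≤ min(k_j,h_j)`, `α₁₁ ≤ h_j` (no `h`-cap,
no budget); then `G₁G₂ ≤ g·(c₀ + pȲ₁Ȳ₂/b_Ȳ + q(1−σ)α₀₁·max(k₁k₂/α₀₁², h₁h₂/(α₀₁α₁₁)) + qσh₁h₂/α₁₁) = g·(gΦ₀ᴳ) ≤ g·phi0Num`.
Proof: `charging_pair` with `ε_Y = pb_Ȳ/g, ε_g = q(1−σ)α₀₁/g, ε_h = qσα₁₁/g, κ = α₀₁/α₁₁, θ = τσ/g`, `model_tying_A/T`, and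
the reduction `T₀ − V₁V₂ = pay − cross`. [this work] -/
theorem phi0_pair_model {τ σ s α00 α01 α11 c0 y₁ y₂ k₁ k₂ g₁ g₂ h₁ h₂ : ℝ} (hτ0 : 0 < τ) (hτ1 : τ < 1) (hσ0 : 0 < σ)
    (hσ1 : σ < 1) (hs0 : 0 < s) (hs1 : s < 1) (hα00 : 0 < α00) (h01 : α00 ≤ α01) (h11 : α01 ≤ α11)
    (hc0 : τ * σ + (1 - s) * (1 - τ) * α00 ≤ c0) (hy1 : α00 ≤ y₁) (hyk1 : y₁ ≤ k₁) (hk1 : k₁ ≤ 1) (hg1 : α01 ≤ g₁)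
    (hgk1 : g₁ ≤ k₁) (hgh1 : g₁ ≤ h₁) (hh1 : α11 ≤ h₁) (hy2 : α00 ≤ y₂) (hyk2 : y₂ ≤ k₂) (hk2 : k₂ ≤ 1) (hg2 : α01 ≤ g₂)
    (hgk2 : g₂ ≤ k₂) (hgh2 : g₂ ≤ h₂) (hh2 : α11 ≤ h₂) :
    (c0 + τ * (1 - σ) * ((1 - s) * y₁ + s * k₁) + s * (1 - τ) * ((1 - σ) * g₁ + σ * h₁)) *
      (c0 + τ * (1 - σ) * ((1 - s) * y₂ + s * k₂) + s * (1 - τ) * ((1 - σ) * g₂ + σ * h₂)) ≤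
    (c0 + τ * (1 - σ) * ((1 - s) * α00 + s * α01) + s * (1 - τ) * ((1 - σ) * α01 + σ * α11)) *
      (c0 + τ * (1 - σ) * (((1 - s) * y₁ + s * k₁) * ((1 - s) * y₂ + s * k₂)) / ((1 - s) * α00 + s * α01) +
        s * (1 - τ) * (1 - σ) * α01 * max (k₁ * k₂ / (α01 * α01)) (h₁ * h₂ / (α01 * α11)) + s * (1 - τ) * σ * (h₁ * h₂) / α11) := by
  obtain ⟨hα01, hα11⟩ : 0 < α01 ∧ 0 < α11 := ⟨lt_of_lt_of_le hα00 h01, lt_of_lt_of_le (lt_of_lt_of_le hα00 h01) h11⟩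
  obtain ⟨hτ1', hσ1', hs1'⟩ : 0 < 1 - τ ∧ 0 < 1 - σ ∧ 0 < 1 - s := ⟨by linarith, by linarith, by linarith⟩
  obtain ⟨hp0, hq0⟩ : 0 < τ * (1 - σ) ∧ 0 < s * (1 - τ) := ⟨mul_pos hτ0 hσ1', mul_pos hs0 hτ1'⟩
  have hbY0 : 0 < (1 - s) * α00 + s * α01 := by linarith [mul_pos hs1' hα00, mul_pos hs0 hα01]
  have hbH0 : 0 < (1 - σ) * α01 + σ * α11 := by linarith [mul_pos hσ1' hα01, mul_pos hσ0 hα11]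
  obtain ⟨g, hgdef⟩ : ∃ g, g = c0 + τ * (1 - σ) * ((1 - s) * α00 + s * α01) + s * (1 - τ) * ((1 - σ) * α01 + σ * α11) := ⟨_, rfl⟩
  have hg0 : 0 < g := by
    rw [hgdef]; linarith [mul_pos hp0 hbY0, mul_pos hq0 hbH0, mul_pos hτ0 hσ0, mul_pos (mul_pos hs1' hτ1') hα00]
  have hY11 : (1 - s) * y₁ + s * k₁ ≤ 1 := by linarith [mul_le_mul_of_nonneg_left (hyk1.trans hk1) hs1'.le, mul_le_mul_of_nonneg_left hk1 hs0.le]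
  have hY21 : (1 - s) * y₂ + s * k₂ ≤ 1 := by linarith [mul_le_mul_of_nonneg_left (hyk2.trans hk2) hs1'.le, mul_le_mul_of_nonneg_left hk2 hs0.le]
  have hsum : c0 / g + τ * (1 - σ) * ((1 - s) * α00 + s * α01) / g + s * (1 - τ) * (1 - σ) * α01 / g +
      s * (1 - τ) * σ * α11 / g = 1 := by field_simp; rw [hgdef]; ring
  have hY0' : 0 ≤ τ * (1 - σ) * ((1 - s) * α00 + s * α01) / g := by positivity
  have hY1'' : τ * (1 - σ) * ((1 - s) * α00 + s * α01) / g < 1 := by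
    rw [div_lt_one hg0, hgdef]; linarith [mul_pos hq0 hbH0, mul_pos hτ0 hσ0, mul_pos (mul_pos hs1' hτ1') hα00]
  obtain ⟨hεg0, hεh0, hθ0⟩ : 0 ≤ s * (1 - τ) * (1 - σ) * α01 / g ∧ 0 ≤ s * (1 - τ) * σ * α11 / g ∧ 0 ≤ τ * σ / g :=
    ⟨by positivity, by positivity, by positivity⟩
  have hθc : τ * σ / g ≤ 1 - τ * (1 - σ) * ((1 - s) * α00 + s * α01) / g - s * (1 - τ) * (1 - σ) * α01 / g -
      s * (1 - τ) * σ * α11 / g := by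
    rw [show 1 - τ * (1 - σ) * ((1 - s) * α00 + s * α01) / g - s * (1 - τ) * (1 - σ) * α01 / g -
        s * (1 - τ) * σ * α11 / g = c0 / g by linarith]
    exact div_le_div_of_nonneg_right (by linarith [mul_pos (mul_pos hs1' hτ1') hα00]) hg0.le
  have hκ0 : 0 < α01 / α11 := by positivity
  obtain ⟨hz1', hz2'⟩ : 1 ≤ g₁ / α01 ∧ 1 ≤ g₂ / α01 := ⟨by rw [le_div_iff₀ hα01]; linarith, by rw [le_div_iff₀ hα01]; linarith⟩
  obtain ⟨hr1', hr2'⟩ : 1 ≤ h₁ / α11 ∧ 1 ≤ h₂ / α11 := ⟨by rw [le_div_iff₀ hα11]; linarith, by rw [le_div_iff₀ hα11]; linarith⟩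
  have hl : ∀ {gg hh : ℝ}, gg ≤ hh → α01 / α11 * (gg / α01) ≤ hh / α11 := by
    intro gg hh hle; rw [div_mul_div_comm, div_le_div_iff₀ (by positivity) hα11]
    have := mul_le_mul_of_nonneg_left hle (mul_pos hα01 hα11).le; linarith [mul_comm α11 α01]
  have hA1 := model_tying_A (kc := k₁) hτ0 hτ1 hσ0 hσ1 hs0 hs1 hα00 h01 h11 hc0 hgdef hy1 hg1 hgk1
  have hA2 := model_tying_A (kc := k₂) hτ0 hτ1 hσ0 hσ1 hs0 hs1 hα00 h01 h11 hc0 hgdef hy2 hg2 hgk2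
  have hT1 := model_tying_T hτ0 hσ0 hσ1 hs0 hs1 hτ1 hα00 h01 h11 hg0 hY11
  have hT2 := model_tying_T hτ0 hσ0 hσ1 hs0 hs1 hτ1 hα00 h01 h11 hg0 hY21
  have hch := charging_pair (x₁ := ((1 - s) * y₁ + s * k₁) / ((1 - s) * α00 + s * α01))
    (x₂ := ((1 - s) * y₂ + s * k₂) / ((1 - s) * α00 + s * α01))
    hY0' hY1'' hεg0 hεh0 hθ0 hθc hκ0 hz1' hz2' hr1' hr2' (hl hgh1) (hl hgh2) hA1 hA2 hT1 hT2
  -- reduction to V₁V₂ ≤ Φ₀ᴳ (cf. `pair_le_phi0G_of_charging`), in opaque names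
  obtain ⟨εY, εg, hεY, hεg⟩ : ∃ a b, a = τ * (1 - σ) * ((1 - s) * α00 + s * α01) / g ∧ b = s * (1 - τ) * (1 - σ) * α01 / g :=
    ⟨_, _, rfl, rfl⟩
  obtain ⟨εh, c, hεh, hcdef⟩ : ∃ a b, a = s * (1 - τ) * σ * α11 / g ∧ b = c0 / g := ⟨_, _, rfl, rfl⟩
  obtain ⟨κ, hκ⟩ : ∃ e, e = α01 / α11 := ⟨_, rfl⟩
  obtain ⟨x₁, x₂, hx1, hx2⟩ : ∃ a b, a = ((1 - s) * y₁ + s * k₁) / ((1 - s) * α00 + s * α01) ∧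
      b = ((1 - s) * y₂ + s * k₂) / ((1 - s) * α00 + s * α01) := ⟨_, _, rfl, rfl⟩
  obtain ⟨z₁, z₂, hz1, hz2⟩ : ∃ a b, a = g₁ / α01 ∧ b = g₂ / α01 := ⟨_, _, rfl, rfl⟩
  obtain ⟨r₁, r₂, hr1, hr2⟩ : ∃ a b, a = h₁ / α11 ∧ b = h₂ / α11 := ⟨_, _, rfl, rfl⟩
  rw [← hεY, ← hεg, ← hεh, ← hκ, ← hx1, ← hx2, ← hz1, ← hz2, ← hr1, ← hr2] at hch
  rw [← hεY, ← hεg, ← hεh, ← hcdef] at hsum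
  rw [← hεg] at hεg0
  simp only [← hz1, ← hz2] at hz1' hz2'
  obtain ⟨hzk1', hzk2'⟩ : z₁ ≤ k₁ / α01 ∧ z₂ ≤ k₂ / α01 :=
    ⟨by rw [hz1]; exact div_le_div_of_nonneg_right hgk1 hα01.le, by rw [hz2]; exact div_le_div_of_nonneg_right hgk2 hα01.le⟩
  obtain ⟨M, hMdef⟩ : ∃ M, M = max (r₁ * r₂ / κ - z₁ * z₂) 0 := ⟨_, rfl⟩
  rw [← hMdef] at hch
  have hmax : z₁ * z₂ + M ≤ max (k₁ / α01 * (k₂ / α01)) (r₁ * r₂ / κ) := by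
    have hK : z₁ * z₂ ≤ k₁ / α01 * (k₂ / α01) := mul_le_mul hzk1' hzk2' (by linarith) (by linarith)
    rcases le_total 0 (r₁ * r₂ / κ - z₁ * z₂) with h | h
    · rw [hMdef, max_eq_left h]; have := le_max_right (k₁ / α01 * (k₂ / α01)) (r₁ * r₂ / κ); linarith
    · rw [hMdef, max_eq_right h]; have := le_max_left (k₁ / α01 * (k₂ / α01)) (r₁ * r₂ / κ); linarith
  have keyV : (c + εY * (x₁ * x₂) + εg * (z₁ * z₂ + M) + εh * (r₁ * r₂)) -
      (c + εY * x₁ + εg * z₁ + εh * r₁) * (c + εY * x₂ + εg * z₂ + εh * r₂) =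
      (εY * (1 - εY) * ((x₁ - 1) * (x₂ - 1)) + εh * (1 - εh) * ((r₁ - 1) * (r₂ - 1)) +
        εg * (1 - εg) * ((z₁ - 1) * (z₂ - 1)) + εg * M) -
      (εg * εY * ((x₁ - 1) * (z₂ - 1) + (x₂ - 1) * (z₁ - 1)) + εh * εY * ((x₁ - 1) * (r₂ - 1) + (x₂ - 1) * (r₁ - 1)) +
        εg * εh * ((z₁ - 1) * (r₂ - 1) + (z₂ - 1) * (r₁ - 1))) := by
    rw [show c = 1 - εY - εg - εh by linarith]; ring
  have hVV : (c + εY * x₁ + εg * z₁ + εh * r₁) * (c + εY * x₂ + εg * z₂ + εh * r₂) ≤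
      c + εY * (x₁ * x₂) + εg * max (k₁ / α01 * (k₂ / α01)) (r₁ * r₂ / κ) + εh * (r₁ * r₂) := by
    have := mul_le_mul_of_nonneg_left hmax hεg0; linarith
  have hG1 := model_value_eq (τ := τ) (σ := σ) (c0 := c0) (yv := y₁) (kc := k₁) (gg := g₁) (hh := h₁) hg0.ne' hbY0.ne' hα01.ne' hα11.ne'
  have hG2 := model_value_eq (τ := τ) (σ := σ) (c0 := c0) (yv := y₂) (kc := k₂) (gg := g₂) (hh := h₂) hg0.ne' hbY0.ne' hα01.ne' hα11.ne'
  have hR := model_rhs_eq (τ := τ) (σ := σ) (c0 := c0) (Y₁ := (1 - s) * y₁ + s * k₁) (Y₂ := (1 - s) * y₂ + s * k₂)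
    (k₁ := k₁) (k₂ := k₂) (h₁ := h₁) (h₂ := h₂) hg0.ne' hbY0.ne' hα01.ne' hα11.ne'
  rw [← hεY, ← hεg, ← hεh, ← hcdef, ← hx1, ← hz1, ← hr1] at hG1
  rw [← hεY, ← hεg, ← hεh, ← hcdef, ← hx2, ← hz2, ← hr2] at hG2
  rw [← hεY, ← hεg, ← hεh, ← hcdef, ← hx1, ← hx2, ← hr1, ← hr2, ← hκ] at hR
  rw [← hgdef, hG1, hG2, hR, show g * (c + εY * x₁ + εg * z₁ + εh * r₁) * (g * (c + εY * x₂ + εg * z₂ + εh * r₂)) =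
      g * g * ((c + εY * x₁ + εg * z₁ + εh * r₁) * (c + εY * x₂ + εg * z₂ + εh * r₂)) by ring,
    show g * (g * (c + εY * (x₁ * x₂) + εg * max (k₁ / α01 * (k₂ / α01)) (r₁ * r₂ / κ) + εh * (r₁ * r₂))) =
      g * g * (c + εY * (x₁ * x₂) + εg * max (k₁ / α01 * (k₂ / α01)) (r₁ * r₂ / κ) + εh * (r₁ * r₂)) by ring]
  exact mul_le_mul_of_nonneg_left hVV (mul_nonneg hg0.le hg0.le)

end Summit.CriticalPhenomena.PercolationContinuityZ3.Theorems.SunflowerPartition.SafeCalc.LinkedCurrency
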